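import Summits.QuantumFields.BalabanUV.T4Continuum.Support.NE7AxialGaugePotential
import Summits.QuantumFields.BalabanUV.T4Continuum.Support.NE7MatrixLogSecondDiff
import Summits.QuantumFields.BalabanUV.T4Continuum.Support.TermwiseHolderNorm
import HarnessLib

/-!
# NE7AxialGaugePotentialHolder — (9)-TYPE FOR ONE CONFIGURATION: every unitary configuration on `ℤ^d` with plaquette radius `a` (`SmallField U a`) and covariant
# flux gradients `‖(∇_U F)(x, κ; π)‖ ≤ b` is `TermwiseHolder.HolderReg U z R₀ η c₀ c₁ β c₂` ABOUT EVERY SITE `z`, for every spacing `0 < η` and every exponent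
# `0 < β`, with EXPLICIT constants: `η·c₀ = 2Ra`, `η²·c₁ = 2δ_R`, `η²·η^β·c₂ = 2R₀·(2σ_R + 4δ_R²)` (`R = (d+1)(3R₀+2)`; `δ_R = d((R+1)p₁ + a)`, `p₁ = 2b + 2(R+1)a·a`,
# `σ_R = d(R(2p₁ + 2p₁δ_R) + p₁ + aδ_R)` from F4) — under the smallness `(R+3)·a ≤ 1∕2`, `a ≤ 1∕4`.  The Hölder clause costs only SECOND differences of the
# potential, whose bound carries `b` or `a²` in every term: the origin of the k-UNIFORMITY for `β < 1` in F5

Cell `pub-balaban`, rung (B)+1 sub-cell t4, lineage `b2b-balaban-t4-ne7-p1` (CRUX PROVER NE7 #1 = OWNER of BINDER row NE7), generation 111.  Memo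
`t4/b2b-balaban-t4-ne7-p1-g111/ROAD-G111.md`.  File F4b of the line «(9)-TYPE k-UNIFORM HÖLDER REGULARITY OF EVERY CONSTRAINED SMALL-FIELD MINIMISER, every β < 1»
(ROAD-G110 §NEXT (N2)); over F4 `NE7AxialGaugePotential`, F4a `NE7MatrixLogSecondDiff`, F1's lattice telescope, and the cell's `TermwiseHolder.HolderReg` (the
(D)-block letter of the HR tower ✓ p812443∕p812547, consumed through `HolderReg.locReg`).
WHAT ([folklore]; 0 def, 0 sorry; every `d`, every `U(n)`).  §1 **`norm_axialLog_secondDiff_le`** (`‖Δ_ιΔ_ι′B‖ ≤ 2σ_R + 4δ_R²` on the region of radius `R`); §2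
`ball_region` (the `l1`-ball of radius `S` about `z` inside the region of the base point `z − S·𝟙`); §3 **`holderReg_of_classData`**.
HONEST FRAMING (page 1): a regularity LETTER about ONE configuration under displayed hypotheses; for Bałaban's∕our minimisers the inputs `a`, `b` are F5's business
(✓ p810303, ✓ `exists_classFluxGradConst_generic`); the letter is lattice-LOCAL (pairs at `l1`-distance ≤ `2R₀`), NOT print's (9) over physical distance `≤ 1`; nothing
of Bałaban's asserted; NOT NE3∕NE7 as spine nodes; spine 0∕9; finite T⁴ rung (B)+1 — NOT infinite volume, NOT mass gap, NOT BetaPertH, NOT Clay.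
-/

set_option autoImplicit false

open scoped BigOperators Matrix Matrix.Norms.L2Operator
open NormedSpace Finset

namespace Summit.QuantumFields.BalabanUV.T4Continuum.NE7AxialGaugePotentialHolder

open Literature.MathematicalPhysics.QuantumFieldTheory.Balaban1983to89
open B7Prop1Explicit B7Prop2Explicit MatrixLog UnitaryModel
open T4AveragingDeficitWall hiding Site Plane Plaq Bond
open AveragingDeficitTransport (mem_U1_of_unitary)
open B11HolderComplex (HolderOn)
open TermwiseHolder (HolderReg)
open NE7MatrixLogSecondDiff (norm_mlog_secondDiff_le)
open NE7AxialRecursionLetters (norm_sub_le_l1_mul)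
open NE7AxialGaugeStrata (axialFn_unitary norm_axial_sub_one_le)
open NE7AxialGaugeLattice (l1_add_e_le)
open NE7AxialGaugePotential (region_add_e axial_firstDiff_le axial_secondDiff_le axial_rep norm_axialLog_le norm_axialLog_diff_le)

noncomputable section

variable {d : ℕ} {n : Type*} [Fintype n] [DecidableEq n] [Nonempty n]

/-! ## §1 Second differences of the potential -/

/-- **SECOND DIFFERENCES OF THE POTENTIAL** `B = log U^{v₀}` on the region `{y ≤ x, l1(x − y) ≤ R}` when `(R+3)·a ≤ 1∕2`: with `p₁ = 2b + 2((R+1)a)a`,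
`δ = d((R+1)p₁ + a)`, `σ = d(R(2p₁ + 2p₁δ) + (p₁ + aδ))`:  `‖Δ_ιΔ_ι′B(·, κ)(x)‖ ≤ 2σ + 4δ²` (the logarithm's `C^{1,1}` letter at radius `1∕2`). [folklore] -/
theorem norm_axialLog_secondDiff_le {U : Site d → Fin d → (Matrix n n ℂ)ˣ} (hU : IsUnitaryCfg U) {a b : ℝ} (hS : SmallField U a)
    (ha0 : 0 ≤ a) (ha4 : a ≤ 1 / 4) (hb0 : 0 ≤ b)
    (hb : ∀ (x : Site d) (κ : Fin d) (π : T4AveragingDeficitWall.Plane d), ‖covGrad U (flux U) x κ π‖ ≤ b)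
    (y : Site d) (R : ℕ) (hRa : ((R + 3 : ℕ) : ℝ) * a ≤ 1 / 2) {x : Site d} (hyx : y ≤ x) (hxR : l1 (x - y) ≤ R) (κ ι ι' : Fin d) :
    ‖mlog ((gaugeAct (axialFn U y) U (x + e ι + e ι') κ : (Matrix n n ℂ)ˣ) : Matrix n n ℂ)
        - mlog ((gaugeAct (axialFn U y) U (x + e ι) κ : (Matrix n n ℂ)ˣ) : Matrix n n ℂ)
        - mlog ((gaugeAct (axialFn U y) U (x + e ι') κ : (Matrix n n ℂ)ˣ) : Matrix n n ℂ)
        + mlog ((gaugeAct (axialFn U y) U x κ : (Matrix n n ℂ)ˣ) : Matrix n n ℂ)‖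
      ≤ 2 * (d * (R * (2 * (2 * b + 2 * (((R + 1 : ℕ) : ℝ) * a) * a)
              + 2 * (2 * b + 2 * (((R + 1 : ℕ) : ℝ) * a) * a) * (d * ((R + 1 : ℕ) * (2 * b + 2 * (((R + 1 : ℕ) : ℝ) * a) * a) + a)))
            + ((2 * b + 2 * (((R + 1 : ℕ) : ℝ) * a) * a) + a * (d * ((R + 1 : ℕ) * (2 * b + 2 * (((R + 1 : ℕ) : ℝ) * a) * a) + a)))))
        + 4 * (d * ((R + 1 : ℕ) * (2 * b + 2 * (((R + 1 : ℕ) : ℝ) * a) * a) + a)) ^ 2 := by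
  set p₁ : ℝ := 2 * b + 2 * (((R + 1 : ℕ) : ℝ) * a) * a with hp₁def
  set δ : ℝ := d * ((R + 1 : ℕ) * p₁ + a) with hδdef
  -- every point met lies in the region of radius `R + 2`, where `‖V₀ − 1‖ ≤ (R+2)a ≤ 1/2`
  have hhalf : ∀ w : Site d, y ≤ w → l1 (w - y) ≤ R + 2 → ‖((gaugeAct (axialFn U y) U w κ : (Matrix n n ℂ)ˣ) : Matrix n n ℂ) - 1‖ ≤ 1 / 2 := by
    intro w hyw hwR
    refine (norm_axial_sub_one_le hU ha0 hS hyw κ).trans ?_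
    have h1 : (l1 (w - y) : ℝ) * a ≤ ((R + 3 : ℕ) : ℝ) * a := mul_le_mul_of_nonneg_right (by exact_mod_cast (hwR.trans (Nat.le_succ _))) ha0
    exact h1.trans hRa
  obtain ⟨hy1, hl1⟩ := region_add_e hyx hxR ι
  obtain ⟨hy2, hl2⟩ := region_add_e hyx hxR ι'
  obtain ⟨hy12, hl12⟩ := region_add_e hy1 hl1 ι'
  -- first differences on the region of radius `R + 1`
  have hfirst : ∀ w : Site d, y ≤ w → l1 (w - y) ≤ R + 1 → ∀ ν lam : Fin d,
      ‖((gaugeAct (axialFn U y) U (w + e lam) ν : (Matrix n n ℂ)ˣ) : Matrix n n ℂ)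
        - ((gaugeAct (axialFn U y) U w ν : (Matrix n n ℂ)ˣ) : Matrix n n ℂ)‖ ≤ δ := by
    intro w hyw hwR ν lam
    have h := axial_firstDiff_le hU hS ha0 ha4 hb0 hb y (R + 1) hyw hwR ν lam
    simpa [hδdef, hp₁def] using h
  have hA := hhalf x hyx (hxR.trans (by omega))
  have hB := hhalf (x + e ι) hy1 (hl1.trans (by omega))
  have hC := hhalf (x + e ι') hy2 (hl2.trans (by omega))
  have hD := hhalf (x + e ι + e ι') hy12 (hl12.trans (by omega))
  have hAB := hfirst x hyx (hxR.trans (Nat.le_succ _)) κ ι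
  have hCD := hfirst (x + e ι') hy2 hl2 κ ι
  rw [add_right_comm] at hCD
  have hAC := hfirst x hyx (hxR.trans (Nat.le_succ _)) κ ι'
  have hBD := hfirst (x + e ι) hy1 hl1 κ ι'
  have h2 := axial_secondDiff_le hU hS ha0 ha4 hb0 hb y R hyx hxR κ ι ι'
  have h := norm_mlog_secondDiff_le (by norm_num : (1 / 2 : ℝ) < 1) hA hB hC hD hAB hCD hAC hBD
  refine h.trans ?_
  have e1 : (1 : ℝ) - 1 / 2 = 1 / 2 := by norm_num
  rw [e1]
  have hδ0 : 0 ≤ δ := by positivity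
  have hσ := h2
  calc _ ≤ (d * (R * (2 * p₁ + 2 * p₁ * δ) + (p₁ + a * δ))) / (1 / 2) + δ * δ / (1 / 2) ^ 2 := by
        gcongr
      _ = _ := by simp only [hp₁def, hδdef]; ring

/-! ## §2 The ball about a site inside the region of a shifted base point -/

/-- The `l1`-ball of radius `S` about `z` lies above the base point `y = z − S·𝟙` with `l1(q − y) ≤ (d+1)·S`. [folklore] -/
theorem ball_region (z : Site d) (S : ℕ) {q : Site d} (hq : l1 (q - z) ≤ S) :
    (z - fun _ => (S : ℤ)) ≤ q ∧ l1 (q - (z - fun _ => (S : ℤ))) ≤ (d + 1) * S := by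
  have hcoord : ∀ i : Fin d, ((q - z) i).natAbs ≤ S := fun i =>
    (Finset.single_le_sum (f := fun j => ((q - z) j).natAbs) (fun j _ => Nat.zero_le _) (Finset.mem_univ i)).trans hq
  have hle : (z - fun _ => (S : ℤ)) ≤ q := fun i => by
    have h2 := hcoord i
    simp only [Pi.sub_apply] at h2
    show z i - (S : ℤ) ≤ q i
    omega
  refine ⟨hle, ?_⟩
  have e1 : q - (z - fun _ => (S : ℤ)) = (q - z) + fun _ => (S : ℤ) := by abel
  rw [e1]
  refine (l1_add_le _ _).trans ?_
  have h5 : l1 (fun _ : Fin d => (S : ℤ)) = d * S := by simp [l1]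
  rw [h5]; nlinarith

/-! ## §3 The (9)-type letter for one configuration -/

omit [Fintype n] [DecidableEq n] [Nonempty n] in
/-- `l1(x − z) = l1(z − x)`. [folklore] -/
theorem l1_sub_comm (x z : Site d) : l1 (x - z) = l1 (z - x) := by
  unfold l1
  refine Finset.sum_congr rfl fun κ _ => ?_
  simp only [Pi.sub_apply]
  omega

omit [Fintype n] [DecidableEq n] [Nonempty n] in
/-- `l1(v) = 0 ⟹ v = 0`. [folklore] -/
theorem eq_of_l1_sub_eq_zero {x x' : Site d} (h : l1 (x' - x) = 0) : x' = x := by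
  unfold l1 at h
  rw [Finset.sum_eq_zero_iff] at h
  funext κ
  have := h κ (Finset.mem_univ κ)
  simp only [Pi.sub_apply] at this
  omega

set_option maxHeartbeats 800000 in
/-- **(9)-TYPE FOR ONE CONFIGURATION.**  Unitary `U` on `ℤ^d` with `SmallField U a`, `a ≤ 1∕4`, covariant flux gradients `≤ b` everywhere, and `(R+3)·a ≤ 1∕2`
for `R = (d+1)(3R₀+2)`: for every site `z`, spacing `0 < η` and exponent `0 < β`, `HolderReg U z R₀ η c₀ c₁ β c₂` with
`c₀ = 2Ra∕η`, `c₁ = 2d(R(2b + 2(Ra)a) + a)∕η²`, `c₂ = 2R₀(2σ + 4δ²)∕(η²·η^β)` (`p₁ = 2b + 2((R+1)a)a`, `δ = d((R+1)p₁ + a)`,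
`σ = d(R(2p₁ + 2p₁δ) + p₁ + aδ)` as in §1). [folklore] -/
theorem holderReg_of_classData {U : Site d → Fin d → (Matrix n n ℂ)ˣ} (hU : IsUnitaryCfg U) {a b : ℝ} (hS : SmallField U a)
    (ha0 : 0 ≤ a) (ha4 : a ≤ 1 / 4) (hb0 : 0 ≤ b)
    (hb : ∀ (x : Site d) (κ : Fin d) (π : T4AveragingDeficitWall.Plane d), ‖covGrad U (flux U) x κ π‖ ≤ b)
    (R₀ : ℕ) {R : ℕ} (hR : R = (d + 1) * (3 * R₀ + 2)) (hRa : ((R + 3 : ℕ) : ℝ) * a ≤ 1 / 2)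
    {η β : ℝ} (hη : 0 < η) (hβ : 0 < β) (z : Site d) :
    HolderReg U z R₀ η (2 * (R : ℝ) * a / η)
      (2 * (d * (R * (2 * b + 2 * ((R : ℝ) * a) * a) + a)) / η ^ 2)
      β
      (2 * R₀ * (2 * (d * (R * (2 * (2 * b + 2 * (((R + 1 : ℕ) : ℝ) * a) * a)
              + 2 * (2 * b + 2 * (((R + 1 : ℕ) : ℝ) * a) * a) * (d * ((R + 1 : ℕ) * (2 * b + 2 * (((R + 1 : ℕ) : ℝ) * a) * a) + a)))
            + ((2 * b + 2 * (((R + 1 : ℕ) : ℝ) * a) * a) + a * (d * ((R + 1 : ℕ) * (2 * b + 2 * (((R + 1 : ℕ) : ℝ) * a) * a) + a)))))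
          + 4 * (d * ((R + 1 : ℕ) * (2 * b + 2 * (((R + 1 : ℕ) : ℝ) * a) * a) + a)) ^ 2)
        / (η ^ 2 * η ^ β)) := by
  -- names for the radii and the constants
  set S : ℕ := 3 * R₀ + 2 with hSdef
  set p₁ : ℝ := 2 * b + 2 * (((R + 1 : ℕ) : ℝ) * a) * a with hp₁def
  set δ : ℝ := d * ((R + 1 : ℕ) * p₁ + a) with hδdef
  set σ : ℝ := d * (R * (2 * p₁ + 2 * p₁ * δ) + (p₁ + a * δ)) with hσdef
  set M₂ : ℝ := 2 * σ + 4 * δ ^ 2 with hM₂def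
  set y : Site d := z - fun _ => (S : ℤ) with hydef
  have hM₂0 : 0 ≤ M₂ := by positivity
  have hηβ : 0 < η ^ β := Real.rpow_pos_of_pos hη β
  have hR1a : ((R + 1 : ℕ) : ℝ) * a ≤ 1 / 2 :=
    (mul_le_mul_of_nonneg_right (by exact_mod_cast (by omega : R + 1 ≤ R + 3)) ha0).trans hRa
  -- the ball of radius `S` about `z` sits in the region of radius `R` above `y`
  have hreg : ∀ q : Site d, l1 (q - z) ≤ S → y ≤ q ∧ l1 (q - y) ≤ R := fun q hq => by
    have h := ball_region z S hq; rw [hR]; exact h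
  have hR₀S : R₀ ≤ S := by omega
  -- second differences of the potential at every site of the ball of radius `S − 1`
  have hM₂ : ∀ p : Site d, l1 (p - z) ≤ S → ∀ κ ι ι' : Fin d,
      ‖mlog ((gaugeAct (axialFn U y) U (p + e ι + e ι') κ : (Matrix n n ℂ)ˣ) : Matrix n n ℂ)
        - mlog ((gaugeAct (axialFn U y) U (p + e ι) κ : (Matrix n n ℂ)ˣ) : Matrix n n ℂ)
        - mlog ((gaugeAct (axialFn U y) U (p + e ι') κ : (Matrix n n ℂ)ˣ) : Matrix n n ℂ)
        + mlog ((gaugeAct (axialFn U y) U p κ : (Matrix n n ℂ)ˣ) : Matrix n n ℂ)‖ ≤ M₂ := by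
    intro p hp κ ι ι'
    obtain ⟨hyp, hpR⟩ := hreg p hp
    have h := norm_axialLog_secondDiff_le hU hS ha0 ha4 hb0 hb y R hRa hyp hpR κ ι ι'
    simpa [hM₂def, hσdef, hδdef, hp₁def] using h
  refine ⟨fun w => (axialFn U y w)⁻¹, fun w ι => mlog ((gaugeAct (axialFn U y) U w ι : (Matrix n n ℂ)ˣ) : Matrix n n ℂ),
    fun w => (U1 (Matrix n n ℂ)).inv_mem (mem_U1_of_unitary (axialFn_unitary hU y w)), ?_, ?_, ?_, ?_⟩
  · -- representation on the ball of radius `R₀`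
    intro x κ hx
    obtain ⟨hyx, hxR⟩ := hreg x (hx.trans hR₀S)
    refine axial_rep hU ha0 hS hyx κ ?_
    have : (l1 (x - y) : ℝ) * a ≤ ((R + 3 : ℕ) : ℝ) * a := mul_le_mul_of_nonneg_right (by exact_mod_cast (hxR.trans (by omega))) ha0
    linarith
  · -- size: `‖B‖ ≤ 2·l1(x − y)·a ≤ 2Ra = η·c₀`
    intro x κ hx
    obtain ⟨hyx, hxR⟩ := hreg x (hx.trans hR₀S)
    have hxa : (l1 (x - y) : ℝ) * a ≤ (R : ℝ) * a := mul_le_mul_of_nonneg_right (by exact_mod_cast hxR) ha0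
    have hhalf : (l1 (x - y) : ℝ) * a ≤ 1 / 2 :=
      hxa.trans ((mul_le_mul_of_nonneg_right (by exact_mod_cast (by omega : R ≤ R + 3)) ha0).trans hRa)
    refine (norm_axialLog_le hU ha0 hS hyx κ hhalf).trans ?_
    have e1 : η * (2 * (R : ℝ) * a / η) = 2 * ((R : ℝ) * a) := by field_simp
    rw [e1]
    linarith
  · -- first differences: `‖Δ_ι B‖ ≤ 2·d(R(2b + 2(Ra)a) + a) = η²·c₁`
    intro x κ ι hx
    obtain ⟨hyx, hxR⟩ := hreg x (hx.trans hR₀S)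
    have h := norm_axialLog_diff_le hU hS ha0 ha4 hb0 hb y R hR1a hyx hxR κ ι
    have e1 : η ^ 2 * (2 * (d * (R * (2 * b + 2 * ((R : ℝ) * a) * a) + a)) / η ^ 2) = 2 * (d * (R * (2 * b + 2 * ((R : ℝ) * a) * a) + a)) := by
      field_simp
    rw [e1]
    exact h
  · -- the Hölder clause: telescoping the first differences through second differences
    intro x x' hP
    beta_reduce
    obtain ⟨⟨hx, hx'⟩, _⟩ := hP
    -- the constant: `η²·c₂·(η·h)^β ≥ 2R₀·M₂` for `h ≥ 1`
    have e2 : η ^ 2 * (2 * R₀ * M₂ / (η ^ 2 * η ^ β)) = 2 * R₀ * M₂ / η ^ β := by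
      field_simp
    rw [e2]
    by_cases hxx : x' = x
    · subst hxx
      rw [sub_self, norm_zero]
      exact mul_nonneg (div_nonneg (by positivity) hηβ.le) (Real.rpow_nonneg (by positivity) β)
    -- `h = l1(x′ − x) ≥ 1`, `h ≤ 2R₀`
    have hh1 : 1 ≤ l1 (x' - x) := by
      rcases Nat.eq_zero_or_pos (l1 (x' - x)) with h0 | h0
      · exact absurd (eq_of_l1_sub_eq_zero h0) hxx
      · exact h0
    have hh2 : l1 (x' - x) ≤ 2 * R₀ := by
      have e1 : x' - x = (x' - z) + (z - x) := by abel
      rw [e1]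
      refine (l1_add_le _ _).trans ?_
      rw [l1_sub_comm z x]
      omega
    -- unit increments of `f(w) = (Δ_· B)(w)` are second differences, bounded by `M₂` on the ball of radius `S`
    have hstep : ∀ (p : Site d) (μ : Fin d), l1 (p - x) ≤ l1 (x' - x) + 1 →
        ‖(fun q : Fin d × Fin d => mlog ((gaugeAct (axialFn U y) U (p + e μ + e q.1) q.2 : (Matrix n n ℂ)ˣ) : Matrix n n ℂ)
              - mlog ((gaugeAct (axialFn U y) U (p + e μ) q.2 : (Matrix n n ℂ)ˣ) : Matrix n n ℂ))
          - (fun q : Fin d × Fin d => mlog ((gaugeAct (axialFn U y) U (p + e q.1) q.2 : (Matrix n n ℂ)ˣ) : Matrix n n ℂ)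
              - mlog ((gaugeAct (axialFn U y) U p q.2 : (Matrix n n ℂ)ˣ) : Matrix n n ℂ))‖ ≤ M₂ := by
      intro p μ hp
      have hpz : l1 (p - z) ≤ S := by
        have e1 : p - z = (p - x) + (x - z) := by abel
        rw [e1]
        have := l1_add_le (p - x) (x - z)
        omega
      refine (pi_norm_le_iff_of_nonneg hM₂0).mpr fun q => ?_
      simp only [Pi.sub_apply]
      have h := hM₂ p hpz q.2 μ q.1
      rw [show mlog ((gaugeAct (axialFn U y) U (p + e μ + e q.1) q.2 : (Matrix n n ℂ)ˣ) : Matrix n n ℂ)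
            - mlog ((gaugeAct (axialFn U y) U (p + e μ) q.2 : (Matrix n n ℂ)ˣ) : Matrix n n ℂ)
            - (mlog ((gaugeAct (axialFn U y) U (p + e q.1) q.2 : (Matrix n n ℂ)ˣ) : Matrix n n ℂ)
              - mlog ((gaugeAct (axialFn U y) U p q.2 : (Matrix n n ℂ)ˣ) : Matrix n n ℂ))
          = mlog ((gaugeAct (axialFn U y) U (p + e μ + e q.1) q.2 : (Matrix n n ℂ)ˣ) : Matrix n n ℂ)
            - mlog ((gaugeAct (axialFn U y) U (p + e μ) q.2 : (Matrix n n ℂ)ˣ) : Matrix n n ℂ)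
            - mlog ((gaugeAct (axialFn U y) U (p + e q.1) q.2 : (Matrix n n ℂ)ˣ) : Matrix n n ℂ)
            + mlog ((gaugeAct (axialFn U y) U p q.2 : (Matrix n n ℂ)ˣ) : Matrix n n ℂ) by abel]
      exact h
    have htel := norm_sub_le_l1_mul
      (fun w : Site d => fun q : Fin d × Fin d =>
        mlog ((gaugeAct (axialFn U y) U (w + e q.1) q.2 : (Matrix n n ℂ)ˣ) : Matrix n n ℂ)
          - mlog ((gaugeAct (axialFn U y) U w q.2 : (Matrix n n ℂ)ˣ) : Matrix n n ℂ)) x x' hstep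
    refine htel.trans ?_
    -- `h·M₂ ≤ 2R₀·M₂ ≤ (2R₀·M₂/η^β)·(η·h)^β`
    have hhR : (l1 (x' - x) : ℝ) ≤ 2 * R₀ := by exact_mod_cast hh2
    have hpow : η ^ β ≤ (η * (l1 (x' - x) : ℝ)) ^ β := by
      refine Real.rpow_le_rpow hη.le ?_ hβ.le
      have : (1 : ℝ) ≤ l1 (x' - x) := by exact_mod_cast hh1
      nlinarith
    calc (l1 (x' - x) : ℝ) * M₂ ≤ 2 * R₀ * M₂ := mul_le_mul_of_nonneg_right hhR hM₂0
      _ = 2 * R₀ * M₂ / η ^ β * η ^ β := by field_simp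
      _ ≤ 2 * R₀ * M₂ / η ^ β * (η * (l1 (x' - x) : ℝ)) ^ β :=
          mul_le_mul_of_nonneg_left hpow (div_nonneg (by positivity) hηβ.le)

end

end Summit.QuantumFields.BalabanUV.T4Continuum.NE7AxialGaugePotentialHolder
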